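import Summits.BirchSwinnertonDyer.BirchSwinnertonDyer.Theorems.UniversalToricDescentToricKernelAtThreeApZeroOddFlatOfPrint
import Summits.BirchSwinnertonDyer.BirchSwinnertonDyer.Theorems.UniversalToricDescentDefectPTSqueeze
import Summits.BirchSwinnertonDyer.BirchSwinnertonDyer.Theorems.ErratumRoadFiveBaseCountShaPrimary
import Summits.BirchSwinnertonDyer.BirchSwinnertonDyer.Theorems.UniversalToricDescentLocalEulerPoincareCharacteristicFact
import HarnessLib

/-!
# Route `UniversalToricDescent` (rev 44) — act E's KERNEL″ `ToricKernelAtThreeApZeroOddDefectPTOfPrint`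
# (item stmt-BirchSwinnertonDyer-26977) HOLDS, proved through the STRONGER torsion-conditional pointwise kernel (act F)

Cell `bsd-wall`, width seat `bsd-wall-utd-p2-w2` (prover g3, 2026-08-28), executing the UTD pen's open XS–S ticket for kernel″
(pss3x g4, STATUS 08:42:59Z: «kernel″ 26977 … for any idle utd seat; recipe in its informal» = squeeze′ p609855 re-threaded ∘
kernel♭′ p609468 + the hfin discharge of SketchE.lean 83b61809d76127bb); `--workitem stmt-BirchSwinnertonDyer-26977`.

## What this file proves (theorems only; no definition, no named fact, no `sorry`)

* §1 `bsdp_three_of_twinWanFrameAtT_odd_of_defectPT` — the POINTWISE kernel of p609468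
  (`UniversalToricDescentKernelFlatOfPrint.bsdp_three_of_twinWanFrameAt_odd_flat`) with (i) the transport hypothesis
  `ToricTransportModThreeFlat` replaced by the three pieces ♭T′ `DefectTransportModThreePT` (26975) → wall 20395 → μ 20400 and
  the two Poitou–Tate leaves (consumed by the squeeze of the sibling file `UniversalToricDescentDefectPTSqueeze`; the wild
  curve's base finiteness that ♭T′ asks for is DISCHARGED here from the kernel's Gross–Zagier–Kolyvagin rank-one data over `K`
  by `SchneiderFreeAdditiveX3.natCard_selmerAcBase_mul_eq_of_rankOne_anyTorsion_shaPrimary`, SketchE.lean's `example`), and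
  (ii) the pointwise twin `hI'` TORSION-CONDITIONAL (act F): its rational Wan clause is owed only under `Λ`-torsion of
  `X^∅_ac(W′/K_∞; slot 𝔭′)` — a weaker hypothesis, so a STRONGER kernel; everything else verbatim.
* §2 `bsdp_three_of_defectPT_of_nonOrdBucketsT_odd` — p609468 §2's twin trichotomy on the torsion-conditional package
  (♭B_T, ♭C₀_T spelled out as two hypotheses); `bsdp_three_of_defectPT_of_nonOrdBuckets_odd` — the same on the route's
  package `TwinWanFrameAtThreeNonOrdBuckets` (25912 = ♭B ∧ ♭C₀) by monotonicity.
* §3 **`toricKernelAtThreeApZeroOddDefectPTOfPrint_proof`** — the item, literally the route decl; and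
  `wAllExclAddWildRankOneSurjTwin_of_defectWallMu_of_nonOrdBuckets_of_print` — rev 44's `closes` body with hK discharged.

PLANNER DATUM (act F, certificate `Cruxes/TwinSplitIMCAtThreeMult/ActF_TorsionConditionalTwin.lean`): with §1–§2 in the tree,
re-typing ♭B 26062 / ♭C₀ 26063 to «∃ frame `L′` ∧ (torsion of `X^∅_ac(W′)` → ∃ k, `3^k·Ch(W′)·R₀⟦T⟧ ⊆ (L′)`)» costs one
`fun … ↦ bsdp_three_of_defectPT_of_nonOrdBucketsT_odd …` closer and removes the research atom `stub_torsionMult` from the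
deciding chain. CONDITIONAL on every displayed hypothesis (♭T′ research, 20395 THE WALL, …); BSD is proved for no curve by this.
-/

noncomputable section

open scoped Classical

set_option linter.dupNamespace false
set_option autoImplicit false

namespace Summit.BirchSwinnertonDyer.BirchSwinnertonDyer.Theorems.UniversalToricDescentKernelDefectPTOfPrint

open WeierstrassCurve NumberField IsDedekindDomain Field
  Literature.NumberTheory.EllipticCurves
  Literature.NumberTheory.EllipticCurves.ModularForms
  Literature.NumberTheory.EllipticCurves.Rank1Residual
  Literature.NumberTheory.EllipticCurves.KrizLi2019
  Literature.NumberTheory.EllipticCurves.LiuZhangZhang2018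
  Summit.BirchSwinnertonDyer.Rank1Residual
  Summit.BirchSwinnertonDyer.Rank1Residual.Additive
  Summit.BirchSwinnertonDyer.Rank1Residual.X11b
  Summit.BirchSwinnertonDyer.Rank1Residual.X11b.AcSelmer
  Summit.BirchSwinnertonDyer.Rank1Residual.X11b.Halves
  Summit.BirchSwinnertonDyer.BirchSwinnertonDyer.Theses.UniversalToricDescent
  Summit.BirchSwinnertonDyer.BirchSwinnertonDyer.Theorems
  Summit.BirchSwinnertonDyer.BirchSwinnertonDyer.Theorems.UniversalToricDescentTwinChoice
  Summit.BirchSwinnertonDyer.BirchSwinnertonDyer.Theorems.UniversalToricDescentWaldspurgerFlat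
  Summit.BirchSwinnertonDyer.BirchSwinnertonDyer.Theorems.UniversalToricDescentKernelOdd
  Summit.BirchSwinnertonDyer.BirchSwinnertonDyer.Theorems.UniversalToricDescentKernelOfPrint
  Summit.BirchSwinnertonDyer.BirchSwinnertonDyer.Theorems.UniversalToricDescentKernelFlatOfPrint
  Summit.BirchSwinnertonDyer.BirchSwinnertonDyer.Theorems.UniversalToricDescentDefectPTSqueeze

/-! ### §1 The pointwise kernel on ♭T′ → wall → μ with a torsion-conditional twin -/

/-- **Pointwise kernel on ♭T′ → wall → μ, TORSION-CONDITIONAL twin** = p609468 §1 with the transport read through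
`UniversalToricDescentDefectPTSqueeze.charIdeal_eq_of_defectPT_of_wall_of_mu_torsionConditional` (♭T′ 26975, wall 20395, μ 20400,
PT ×2; the wild base finiteness discharged from `rank E(K) = 1`, `Ш(E/K)` finite, the Heegner point — Kolyvagin — by the
any-torsion base count) and the pointwise twin's Wan clause owed only under torsion of `X^∅_ac(W′)`. The `Λ`-torsion of
`X^∅_ac(E)` is `hn.1` of the additive control, read first, as in kernel♭. CONDITIONAL on every displayed hypothesis; BSD is
proved for no curve by this. [cite: JetchevSkinnerWan2017, §7.4.1] [cite: FriedbergHoffstein1995, Thm. B]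
[cite: GreenbergVatsal2000, Thm. (1.4)] -/
theorem bsdp_three_of_twinWanFrameAtT_odd_of_defectPT (hF : ToricPublishedInputs)
    (hD : DefectTransportModThreePT) (hwall : AdditiveSplitIMCInclusionAtThree) (hmu : TwinMuZeroAtThree)
    (hPT : PoitouTateSelmerStructureDualityFact) (hPT2 : PoitouTateShaTateDualFact)
    (hV : ∀ (W : WeierstrassCurve ℚ) [W.IsElliptic] [W.IsGloballyMinimal] (N : ℕ) [NeZero N] (K : Type)
      [Field K] [NumberField K] (Dt : ModularParametrizationData W N) (H : HeegnerDatum N (NumberField.discr K))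
      (ι : K →+* ℂ) (P : (W.baseChange K).toAffine.Point),
      Additive.ClassO6 W 3 → W.HasSurjectiveModNGaloisRep 3 → W.analyticRank = 1 → W.conductorNorm ℤ = N →
      IsImaginaryQuadratic K → SatisfiesHeegnerHypothesis N K → Odd (NumberField.discr K) →
      (W.quadraticTwist (NumberField.discr K : ℚ)).entireLFunction 1 ≠ 0 →
      (WeierstrassCurve.Affine.Point.map ι.toRatAlgHom) P = heegnerPointComplex Dt H → ¬ IsOfFinAddOrder P →
      ∀ (κ : ZpExtension K 3), κ.IsAnticyclotomic → ∀ (γ : absoluteGaloisGroup K) [Fact (κ.IsTopGenerator γ)]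
        (𝔭 : HeightOneSpectrum (𝓞 K)) (h𝔭 : ((3 : ℕ) : 𝓞 K) ∈ 𝔭.asIdeal)
        (he : 𝔭.asIdeal.ramificationIdx (𝓞 ℚ) = 1) (hf : 𝔭.asIdeal.inertiaDeg (𝓞 ℚ) = 1),
        ∃ ι' : PadicAlgCl 3 ≃+* ℂ, SchneiderFree.BranchInducesPrime 3 ι' 𝔭 ∧
          ∃ (ΩK : ℂ) (Ωp : ℂ_[3]) (L : UnrSeries 3), ΩK ≠ 0 ∧ Ωp ≠ 0 ∧ IsBDPLFunction ι' 𝔭 κ γ Dt.f ΩK Ωp L ∧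
            ∃ u : (unrIntegers 3)ˣ, L.HasValueAt 0 ((((u : unrIntegers 3) : unrIntegers 3) : ℂ_[3]) *
              (algebraMap ℚ_[3] ℂ_[3] (logOmega W 3 (embAt K 3 𝔭 h𝔭 he hf) P / (Dt.c : ℚ_[3]))) ^ 2))
    (hC : WildSplitControlAtThree) (hZ : WildRankZeroTwistAtThree)
    (W : WeierstrassCurve ℚ) [W.IsElliptic] [W.IsGloballyMinimal]
    (hO6 : Additive.ClassO6 W 3) (hr : W.analyticRank = 1) (hsurj : W.HasSurjectiveModNGaloisRep 3)
    (W' : WeierstrassCurve ℚ) [W'.IsElliptic] [W'.IsGloballyMinimal]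
    (hcong : O6.ModPCongruent W' W 3) (hW'ss : ¬ Addv W' 3)
    (hI' : ∀ (N' : ℕ) [NeZero N'] (K : Type) [Field K] [NumberField K]
      (Dt' : ModularParametrizationData W' N'), W'.conductorNorm ℤ = N' → IsImaginaryQuadratic K →
      SatisfiesHeegnerHypothesis N' K → Odd (NumberField.discr K) →
      ∀ (κ : ZpExtension K 3), κ.IsAnticyclotomic →
      ∀ (γ : absoluteGaloisGroup K) [Fact (κ.IsTopGenerator γ)] (𝔭 : HeightOneSpectrum (𝓞 K)),
        ((3 : ℕ) : 𝓞 K) ∈ 𝔭.asIdeal → 𝔭.asIdeal.ramificationIdx (𝓞 ℚ) = 1 →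
        𝔭.asIdeal.inertiaDeg (𝓞 ℚ) = 1 →
      ∀ (𝔭' : HeightOneSpectrum (𝓞 K)), ((3 : ℕ) : 𝓞 K) ∈ 𝔭'.asIdeal → 𝔭' ≠ 𝔭 →
      ∀ (ι' : PadicAlgCl 3 ≃+* ℂ), SchneiderFree.BranchInducesPrime 3 ι' 𝔭 →
        ∃ (ΩK : ℂ) (Ωp : ℂ_[3]) (L' : UnrSeries 3), ΩK ≠ 0 ∧ Ωp ≠ 0 ∧
          IsBDPLFunction ι' 𝔭 κ γ Dt'.f ΩK Ωp L' ∧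
          (Module.IsTorsion (IwasawaAlgebra 3) (XAc (W'.baseChange K) 3 κ 𝔭' ∅ γ) →
            ∃ k : ℕ, ∀ G ∈ (XAc.charIdeal (W'.baseChange K) 3 κ 𝔭' ∅ γ).map (PowerSeries.map (toUnr 3)),
              PowerSeries.C (((3 : ℕ) : unrIntegers 3) ^ k) * G ∈ Ideal.span {L'})) :
    BSDp W 3 := by
  -- adapted from p609468 `bsdp_three_of_twinWanFrameAt_odd_flat` (utd-p1 g11); the changes are marked «act E» / «act F»
  obtain ⟨hGZ, hKo, hGZK, hmod, hmodP, -, hGZ73, hFH, hpar, hHP⟩ := hF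
  haveI hN0 : NeZero (W.conductorNorm ℤ) := ⟨W.conductorNorm_pos_holds.ne'⟩
  haveI hN0' : NeZero (W'.conductorNorm ℤ) := ⟨W'.conductorNorm_pos_holds.ne'⟩
  have hw : W.rootNumber = -1 := by
    rcases W.rootNumber_eq_one_or with h | h
    · exfalso
      have heven : Even W.analyticRank := (hpar W).mpr h
      rw [hr] at heven
      exact Nat.not_even_one heven
    · exact h
  obtain ⟨K, _, _, hK, -, hHN, hH2N', hLt⟩ :=
    hFH W hw (2 * W'.conductorNorm ℤ) (mul_ne_zero two_ne_zero hN0'.out) 0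
  have hHN' : SatisfiesHeegnerHypothesis (W'.conductorNorm ℤ) K :=
    SatisfiesHeegnerHypothesis.of_dvd (dvd_mul_left _ 2) hH2N'
  have hodd : Odd (NumberField.discr K) := by
    have h8 := Literature.SatisfiesHeegnerHypothesis.discr_emod_eight hK.1 hH2N' (dvd_mul_right 2 _)
    rw [Int.odd_iff]; omega
  have h3N : 3 ∣ W.conductorNorm ℤ :=
    (W.dvd_conductorNorm_iff_not_hasGoodReductionAtPrime 3).mpr (not_good_of_addv W 3 hO6.2.1)
  have hsplit : SplitsIn K 3 := hHN 3 Nat.prime_three h3N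
  obtain ⟨P, Dt, H, ι, hP⟩ := hHP W K hK hHN
  have hL0 : W.entireLFunction 1 = 0 := entireLFunction_one_eq_zero_of_analyticRank_eq_one hr
  obtain ⟨-, hderiv⟩ := leadingLCoeff_eq_deriv_of_analyticRank_eq_one hr
  have hLK : LDerivEK W K ≠ 0 := by
    rw [lDerivEK_eq_deriv_mul W K hmod hL0]; exact mul_ne_zero hderiv hLt
  have hnt : ¬ IsOfFinAddOrder P :=
    (lDerivEK_ne_zero_iff_not_isOfFinAddOrder W (W.conductorNorm ℤ) K (hGZ _ W K) hK hHN
      ⟨Dt, H, ι, hP⟩).mp hLK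
  obtain ⟨hrk, hfin⟩ := hKo (W.conductorNorm ℤ) W K hK hHN ⟨Dt, H, ι, hP⟩ hnt
  obtain ⟨Dt'⟩ := hmodP W'
  obtain ⟨κ, γ, -, hκ, hγ, -⟩ := X11b.exists_anticyclotomic_generator_prime (p := 3) hK
  haveI : Fact (κ.IsTopGenerator γ) := ⟨hγ⟩
  obtain ⟨𝔭, h𝔭, he, hf⟩ := X11b.exists_degreeOnePrime_of_splitsIn K 3 hK.1 hsplit
  obtain ⟨𝔭', hne, h𝔭', he', hf'⟩ := X11b.Three.exists_ne_degreeOne_prime hK.1 h𝔭 he hf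
  obtain ⟨ι', hind, ΩK, Ωp, L, hΩK, hΩp, hBDP, u, hval⟩ :=
    hV W (W.conductorNorm ℤ) K Dt H ι P hO6 hsurj hr rfl hK hHN hodd hLt hP hnt κ hκ γ 𝔭 h𝔭 he hf
  -- «act F»: the twin's frame with its TORSION-CONDITIONAL rational Wan clause
  have hwan' := hI' (W'.conductorNorm ℤ) K Dt' rfl hK hHN' hodd κ hκ γ 𝔭 h𝔭 he hf 𝔭' h𝔭' hne ι' hind
  have hctl : SchneiderFree.AdditiveControlOnTreeAt 3 κ 𝔭' γ (embAt K 3 𝔭' h𝔭' he' hf') P :=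
    hC W (W.conductorNorm ℤ) K Dt H ι P hO6 hsurj hr rfl hK hHN hLt hP hnt (hKo _ W K) κ hκ γ 𝔭'
      h𝔭' he' hf'
  obtain ⟨n, hn, hneq⟩ := hctl
  -- «act E»: the wild curve's base finiteness at every `v ∋ 3`, from rank-one data over `K` (SketchE.lean `example`)
  have hfinE : ∀ (v : HeightOneSpectrum (𝓞 K)), ((3 : ℕ) : 𝓞 K) ∈ v.asIdeal →
      Finite (selmerAcBase (W.baseChange K) 3 v ∅) := by
    intro v hv
    haveI : Finite (W.baseChange K).sha := hfin
    have hSha3 : Finite (AddCommGroup.primaryComponent (W.baseChange K).sha 3) := inferInstance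
    obtain ⟨he'', hf''⟩ := X11b.degreeOne_of_splitsIn hK.1 hsplit hv
    obtain ⟨hfinv, -⟩ :=
      SchneiderFreeAdditiveX3.natCard_selmerAcBase_mul_eq_of_rankOne_anyTorsion_shaPrimary W 3 K (hPT K)
        (localEulerPoincareCharacteristicFact_proof K) hK hsplit hrk hSha3 P hnt v hv he'' hf''
    exact hfinv
  -- «act E/F»: ♭T′ → wall → μ squeeze (torsion-conditional currency): IMC EQUALITY for `E` at `L`
  have heq : (XAc.charIdeal (W.baseChange K) 3 κ 𝔭' ∅ γ).map (PowerSeries.map (toUnr 3)) =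
      Ideal.span {L} :=
    charIdeal_eq_of_defectPT_of_wall_of_mu_torsionConditional W W' (W.conductorNorm ℤ) (W'.conductorNorm ℤ) K Dt Dt'
      hD hwall hmu hPT hPT2 hO6 hsurj hr rfl hcong hW'ss rfl hK hHN hHN' hfinE κ hκ γ 𝔭 h𝔭 he hf 𝔭' h𝔭' hne ι' hind
      hn.1 hwan' hΩK hΩp hBDP
  have hval' : L.HasValueAt 0 ((((u : unrIntegers 3) : unrIntegers 3) : ℂ_[3]) *
      (algebraMap ℚ_[3] ℂ_[3]
        (logOmega W 3 (embAt K 3 𝔭' h𝔭' he' hf') P / (Dt.c : ℚ_[3]))) ^ 2) :=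
    (SchneiderFreeAdditiveX3.hasValueAt_sq_logOmega_embAt_iff_of_rank_one W 3 hK.1 hrk h𝔭 he hf
      h𝔭' he' hf' P _ _ L).mpr hval
  have hc0 : Dt.c ≠ 0 := Dt.maninConstant_ne_zero_holds
  have hlog : logOmega W 3 (embAt K 3 𝔭' h𝔭' he' hf') P ≠ 0 := X11b.R1.logOmega_ne_zero W 3 _ hnt
  have hlow : SchneiderFree.AdditiveIMCLowerBDPOnTreeLeAt 3 κ 𝔭' γ (embAt K 3 𝔭' h𝔭' he' hf')
      (padicValNat 3 Dt.c.natAbs) P := by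
    obtain ⟨htors, f, hfI, hf0, hfn⟩ := hn
    have hmem : PowerSeries.map (toUnr 3) f ∈ Ideal.span {L} := by
      have h3 := heq.le
      rw [hfI, CongruenceLimit.map_span_singleton_powerSeries] at h3
      exact (Ideal.span_singleton_le_iff_mem _).mp h3
    obtain ⟨-, hle⟩ := Supersingular.two_mul_valuation_le_of_mem_span 3 hf0 hmem u hval'
    have hc0' : (Dt.c : ℚ_[3]) ≠ 0 := by exact_mod_cast hc0
    rw [div_eq_mul_inv, Padic.valuation_mul hlog (inv_ne_zero hc0'), Padic.valuation_inv,
      Padic.valuation_intCast, valuation_logOmega hlog, hfn] at hle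
    refine ⟨n, ⟨htors, f, hfI, hf0, hfn⟩, ?_⟩
    simp only [padicValInt] at hle
    linarith
  have hup : SchneiderFree.Upper.AdditiveIMCUpperBDPOnTreeLeAt 3 κ 𝔭' γ (embAt K 3 𝔭' h𝔭' he' hf')
      (padicValNat 3 Dt.c.natAbs) P :=
    SchneiderFree.Upper.additiveIMCUpperBDPOnTreeLeAt_of_value_of_dvd' hn heq.ge u hc0 hlog hval'
  have hlo : SchneiderFree.IndexLowerBoundLeAt W 3 K P (padicValNat 3 Dt.c.natAbs) :=
    SchneiderFreeAdditiveX3.indexLowerBoundLeAt_of_imcLowerLe_of_control rfl hK hHN hfin hlow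
      ⟨n, hn, hneq⟩
  have hupI : SchneiderFree.Upper.IndexUpperBoundLeAt W 3 K P (padicValNat 3 Dt.c.natAbs) :=
    SchneiderFree.Upper.indexUpperBoundLeAt_of_imcUpperLe_of_control rfl hK hHN hfin hup ⟨n, hn, hneq⟩
  have hD0 : (NumberField.discr K : ℚ) ≠ 0 := by exact_mod_cast NumberField.discr_ne_zero K
  haveI : (W.quadraticTwist (NumberField.discr K : ℚ)).IsElliptic := W.isElliptic_quadraticTwist hD0
  obtain ⟨Cd, hCd⟩ := hasGlobalMinimalModel_rat_holds (W.quadraticTwist (NumberField.discr K : ℚ))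
  haveI : (Cd • W.quadraticTwist (NumberField.discr K : ℚ)).IsGloballyMinimal := hCd
  exact SchneiderFree.Exact.bsdp_three_of_exactIndexManin_of_wAllExclAddWildRankZero hGZ hKo hGZK hmod
    hGZ73 hZ W hO6 hsurj hr (W.conductorNorm ℤ) K Dt H ι P
    (Cd • W.quadraticTwist (NumberField.discr K : ℚ)) rfl hK hodd hHN hLt hP ⟨Cd, rfl⟩ hlo hupI

/-! ### §2 The twin trichotomy on the (torsion-conditional) non-ordinary package -/

/-- **p609468 §2 on ♭T′ → wall → μ and the TORSION-CONDITIONAL non-ordinary package** (♭B_T, ♭C₀_T spelled out as `hB`, `hS0`):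
good-ss twins traded for the supplied `a₃ = 0` twin (♭C₀_T), multiplicative twins by ♭B_T, good-ordinary twins by Yan–Zhu 5.7(1)
alone (IMC equality ⟹ the clause with `k = 0`, torsion hypothesis unused). [folklore] -/
theorem bsdp_three_of_defectPT_of_nonOrdBucketsT_odd (hF : ToricPublishedInputs)
    (hD : DefectTransportModThreePT) (hwall : AdditiveSplitIMCInclusionAtThree) (hmu : TwinMuZeroAtThree)
    (hPT : PoitouTateSelmerStructureDualityFact) (hPT2 : PoitouTateShaTateDualFact) (hYZ : YanZhuMainConjectureInput)
    (hB : ∀ (W' : WeierstrassCurve ℚ) [W'.IsElliptic] [W'.IsGloballyMinimal] (N' : ℕ) [NeZero N'] (K : Type) [Field K]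
      [NumberField K] (Dt' : ModularParametrizationData W' N'),
      Mult W' 3 → W'.HasSurjectiveModNGaloisRep 3 → W'.conductorNorm ℤ = N' → IsImaginaryQuadratic K →
      SatisfiesHeegnerHypothesis N' K → Odd (NumberField.discr K) →
      ∀ (κ : ZpExtension K 3), κ.IsAnticyclotomic → ∀ (γ : absoluteGaloisGroup K) [Fact (κ.IsTopGenerator γ)]
        (𝔭 : HeightOneSpectrum (𝓞 K)), ((3 : ℕ) : 𝓞 K) ∈ 𝔭.asIdeal →
        𝔭.asIdeal.ramificationIdx (𝓞 ℚ) = 1 → 𝔭.asIdeal.inertiaDeg (𝓞 ℚ) = 1 →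
        ∀ (𝔭' : HeightOneSpectrum (𝓞 K)), ((3 : ℕ) : 𝓞 K) ∈ 𝔭'.asIdeal → 𝔭' ≠ 𝔭 →
        ∀ (ι' : PadicAlgCl 3 ≃+* ℂ), SchneiderFree.BranchInducesPrime 3 ι' 𝔭 →
        ∃ (ΩK : ℂ) (Ωp : ℂ_[3]) (L : UnrSeries 3), ΩK ≠ 0 ∧ Ωp ≠ 0 ∧ IsBDPLFunction ι' 𝔭 κ γ Dt'.f ΩK Ωp L ∧
          (Module.IsTorsion (IwasawaAlgebra 3) (XAc (W'.baseChange K) 3 κ 𝔭' ∅ γ) →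
            ∃ k : ℕ, ∀ G ∈ (XAc.charIdeal (W'.baseChange K) 3 κ 𝔭' ∅ γ).map (PowerSeries.map (toUnr 3)),
              PowerSeries.C (((3 : ℕ) : unrIntegers 3) ^ k) * G ∈ Ideal.span {L}))
    (hS0 : ∀ (W' : WeierstrassCurve ℚ) [W'.IsElliptic] [W'.IsGloballyMinimal] (N' : ℕ) [NeZero N'] (K : Type) [Field K]
      [NumberField K] (Dt' : ModularParametrizationData W' N'),
      GoodSS W' 3 → W'.frobeniusTrace 3 = 0 → W'.HasSurjectiveModNGaloisRep 3 → W'.conductorNorm ℤ = N' →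
      IsImaginaryQuadratic K → SatisfiesHeegnerHypothesis N' K → Odd (NumberField.discr K) →
      ∀ (κ : ZpExtension K 3), κ.IsAnticyclotomic → ∀ (γ : absoluteGaloisGroup K) [Fact (κ.IsTopGenerator γ)]
        (𝔭 : HeightOneSpectrum (𝓞 K)), ((3 : ℕ) : 𝓞 K) ∈ 𝔭.asIdeal →
        𝔭.asIdeal.ramificationIdx (𝓞 ℚ) = 1 → 𝔭.asIdeal.inertiaDeg (𝓞 ℚ) = 1 →
        ∀ (𝔭' : HeightOneSpectrum (𝓞 K)), ((3 : ℕ) : 𝓞 K) ∈ 𝔭'.asIdeal → 𝔭' ≠ 𝔭 →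
        ∀ (ι' : PadicAlgCl 3 ≃+* ℂ), SchneiderFree.BranchInducesPrime 3 ι' 𝔭 →
        ∃ (ΩK : ℂ) (Ωp : ℂ_[3]) (L : UnrSeries 3), ΩK ≠ 0 ∧ Ωp ≠ 0 ∧ IsBDPLFunction ι' 𝔭 κ γ Dt'.f ΩK Ωp L ∧
          (Module.IsTorsion (IwasawaAlgebra 3) (XAc (W'.baseChange K) 3 κ 𝔭' ∅ γ) →
            ∃ k : ℕ, ∀ G ∈ (XAc.charIdeal (W'.baseChange K) 3 κ 𝔭' ∅ γ).map (PowerSeries.map (toUnr 3)),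
              PowerSeries.C (((3 : ℕ) : unrIntegers 3) ^ k) * G ∈ Ideal.span {L}))
    (hsupply : ∀ (W : WeierstrassCurve ℚ) [W.IsElliptic] [W.IsGloballyMinimal], Additive.ClassO6 W 3 →
      W.analyticRank = 1 → W.HasSurjectiveModNGaloisRep 3 → HasGoodSSTwinAtThree W →
      HasGoodSSApZeroTwinAtThree W)
    (hV : ∀ (W : WeierstrassCurve ℚ) [W.IsElliptic] [W.IsGloballyMinimal] (N : ℕ) [NeZero N] (K : Type)
      [Field K] [NumberField K] (Dt : ModularParametrizationData W N) (H : HeegnerDatum N (NumberField.discr K))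
      (ι : K →+* ℂ) (P : (W.baseChange K).toAffine.Point),
      Additive.ClassO6 W 3 → W.HasSurjectiveModNGaloisRep 3 → W.analyticRank = 1 → W.conductorNorm ℤ = N →
      IsImaginaryQuadratic K → SatisfiesHeegnerHypothesis N K → Odd (NumberField.discr K) →
      (W.quadraticTwist (NumberField.discr K : ℚ)).entireLFunction 1 ≠ 0 →
      (WeierstrassCurve.Affine.Point.map ι.toRatAlgHom) P = heegnerPointComplex Dt H → ¬ IsOfFinAddOrder P →
      ∀ (κ : ZpExtension K 3), κ.IsAnticyclotomic → ∀ (γ : absoluteGaloisGroup K) [Fact (κ.IsTopGenerator γ)]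
        (𝔭 : HeightOneSpectrum (𝓞 K)) (h𝔭 : ((3 : ℕ) : 𝓞 K) ∈ 𝔭.asIdeal)
        (he : 𝔭.asIdeal.ramificationIdx (𝓞 ℚ) = 1) (hf : 𝔭.asIdeal.inertiaDeg (𝓞 ℚ) = 1),
        ∃ ι' : PadicAlgCl 3 ≃+* ℂ, SchneiderFree.BranchInducesPrime 3 ι' 𝔭 ∧
          ∃ (ΩK : ℂ) (Ωp : ℂ_[3]) (L : UnrSeries 3), ΩK ≠ 0 ∧ Ωp ≠ 0 ∧ IsBDPLFunction ι' 𝔭 κ γ Dt.f ΩK Ωp L ∧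
            ∃ u : (unrIntegers 3)ˣ, L.HasValueAt 0 ((((u : unrIntegers 3) : unrIntegers 3) : ℂ_[3]) *
              (algebraMap ℚ_[3] ℂ_[3] (logOmega W 3 (embAt K 3 𝔭 h𝔭 he hf) P / (Dt.c : ℚ_[3]))) ^ 2))
    (hC : WildSplitControlAtThree) (hZ : WildRankZeroTwistAtThree) :
    ∀ (W : WeierstrassCurve ℚ) [W.IsElliptic] [W.IsGloballyMinimal], Additive.ClassO6 W 3 →
      W.analyticRank = 1 → W.HasSurjectiveModNGaloisRep 3 →
      (∃ (W' : WeierstrassCurve ℚ) (_ : W'.IsElliptic) (_ : W'.IsGloballyMinimal),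
        O6.ModPCongruent W' W 3 ∧ ¬ Addv W' 3 ∧ W'.HasSurjectiveModNGaloisRep 3) → BSDp W 3 := by
  -- adapted from p609468 §2 (utd-p1 g11)
  intro W _ _ hO6 hr hsurj htwin
  obtain ⟨W', hW'e, hW'm, hcong, hW'ss, hW'surj⟩ := htwin
  by_cases hgood : W'.HasGoodReductionAtPrime 3
  · by_cases hss : (3 : ℤ) ∣ W'.frobeniusTrace 3
    · obtain ⟨W'', hW''e, hW''m, hcong'', hW''ss, ha0⟩ :=
        hsupply W hO6 hr hsurj ⟨W', hW'e, hW'm, hcong, hgood, by exact_mod_cast hss⟩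
      have hW''surj : W''.HasSurjectiveModNGaloisRep 3 := by
        obtain ⟨e, he⟩ := hcong''
        refine GaloisImage.hasSurjectiveModNGaloisRep_of_torsionIso e.symm (fun σ Q ↦ ?_) hsurj
        apply e.injective
        rw [he, e.apply_symm_apply, e.apply_symm_apply]
      exact bsdp_three_of_twinWanFrameAtT_odd_of_defectPT hF hD hwall hmu hPT hPT2 hV hC hZ W hO6 hr hsurj W'' hcong''
        (fun h ↦ h.1 hW''ss.1)
        (fun N' _ K _ _ Dt' hN hK hHK hodd κ hκ γ _ 𝔭 h𝔭 he hf 𝔭' h𝔭' hne ι' hι ↦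
          hS0 W'' N' K Dt' hW''ss ha0 hW''surj hN hK hHK hodd κ hκ γ 𝔭 h𝔭 he hf 𝔭' h𝔭' hne ι' hι)
    · refine bsdp_three_of_twinWanFrameAtT_odd_of_defectPT hF hD hwall hmu hPT hPT2 hV hC hZ W hO6 hr hsurj W' hcong
        hW'ss ?_
      intro N' _ K _ _ Dt' hN hK hH hodd κ hκ γ _ 𝔭 h𝔭 he hf 𝔭' h𝔭' hne ι' hι
      obtain ⟨⟨ΩK, Ωp, L', hΩK, hΩp, hBDP'⟩, hall⟩ :=
        ThreeAdicImageOverK.twinSplitIMCAtThreeGoodOrd_of_yanZhu57 hYZ W' N' K Dt'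
          ⟨hgood, by exact_mod_cast hss⟩ hW'surj hN hK hH hodd κ hκ γ 𝔭 h𝔭 he hf 𝔭' h𝔭' hne ι' hι
      refine ⟨ΩK, Ωp, L', hΩK, hΩp, hBDP', fun _ ↦ ⟨0, fun G hG ↦ ?_⟩⟩
      rw [hall ΩK Ωp L' hΩK hΩp hBDP'] at hG
      simpa using hG
  · have hmult : W'.HasMultiplicativeReductionAtPrime 3 := by
      by_contra h
      exact hW'ss ⟨hgood, h⟩
    exact bsdp_three_of_twinWanFrameAtT_odd_of_defectPT hF hD hwall hmu hPT hPT2 hV hC hZ W hO6 hr hsurj W' hcong hW'ss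
      (fun N' _ K _ _ Dt' hN hK hHK hodd κ hκ γ _ 𝔭 h𝔭 he hf 𝔭' h𝔭' hne ι' hι ↦
        hB W' N' K Dt' hmult hW'surj hN hK hHK hodd κ hκ γ 𝔭 h𝔭 he hf 𝔭' h𝔭' hne ι' hι)

/-- **The same on the route's package `TwinWanFrameAtThreeNonOrdBuckets`** (25912 = ♭B 26062 ∧ ♭C₀ 26063, unconditional clause)
by monotonicity (an unconditional clause ignores the torsion hypothesis). [folklore] -/
theorem bsdp_three_of_defectPT_of_nonOrdBuckets_odd (hF : ToricPublishedInputs)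
    (hD : DefectTransportModThreePT) (hwall : AdditiveSplitIMCInclusionAtThree) (hmu : TwinMuZeroAtThree)
    (hPT : PoitouTateSelmerStructureDualityFact) (hPT2 : PoitouTateShaTateDualFact) (hYZ : YanZhuMainConjectureInput)
    (h3 : TwinWanFrameAtThreeNonOrdBuckets)
    (hsupply : ∀ (W : WeierstrassCurve ℚ) [W.IsElliptic] [W.IsGloballyMinimal], Additive.ClassO6 W 3 →
      W.analyticRank = 1 → W.HasSurjectiveModNGaloisRep 3 → HasGoodSSTwinAtThree W →
      HasGoodSSApZeroTwinAtThree W)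
    (hV : ∀ (W : WeierstrassCurve ℚ) [W.IsElliptic] [W.IsGloballyMinimal] (N : ℕ) [NeZero N] (K : Type)
      [Field K] [NumberField K] (Dt : ModularParametrizationData W N) (H : HeegnerDatum N (NumberField.discr K))
      (ι : K →+* ℂ) (P : (W.baseChange K).toAffine.Point),
      Additive.ClassO6 W 3 → W.HasSurjectiveModNGaloisRep 3 → W.analyticRank = 1 → W.conductorNorm ℤ = N →
      IsImaginaryQuadratic K → SatisfiesHeegnerHypothesis N K → Odd (NumberField.discr K) →
      (W.quadraticTwist (NumberField.discr K : ℚ)).entireLFunction 1 ≠ 0 →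
      (WeierstrassCurve.Affine.Point.map ι.toRatAlgHom) P = heegnerPointComplex Dt H → ¬ IsOfFinAddOrder P →
      ∀ (κ : ZpExtension K 3), κ.IsAnticyclotomic → ∀ (γ : absoluteGaloisGroup K) [Fact (κ.IsTopGenerator γ)]
        (𝔭 : HeightOneSpectrum (𝓞 K)) (h𝔭 : ((3 : ℕ) : 𝓞 K) ∈ 𝔭.asIdeal)
        (he : 𝔭.asIdeal.ramificationIdx (𝓞 ℚ) = 1) (hf : 𝔭.asIdeal.inertiaDeg (𝓞 ℚ) = 1),
        ∃ ι' : PadicAlgCl 3 ≃+* ℂ, SchneiderFree.BranchInducesPrime 3 ι' 𝔭 ∧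
          ∃ (ΩK : ℂ) (Ωp : ℂ_[3]) (L : UnrSeries 3), ΩK ≠ 0 ∧ Ωp ≠ 0 ∧ IsBDPLFunction ι' 𝔭 κ γ Dt.f ΩK Ωp L ∧
            ∃ u : (unrIntegers 3)ˣ, L.HasValueAt 0 ((((u : unrIntegers 3) : unrIntegers 3) : ℂ_[3]) *
              (algebraMap ℚ_[3] ℂ_[3] (logOmega W 3 (embAt K 3 𝔭 h𝔭 he hf) P / (Dt.c : ℚ_[3]))) ^ 2))
    (hC : WildSplitControlAtThree) (hZ : WildRankZeroTwistAtThree) :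
    ∀ (W : WeierstrassCurve ℚ) [W.IsElliptic] [W.IsGloballyMinimal], Additive.ClassO6 W 3 →
      W.analyticRank = 1 → W.HasSurjectiveModNGaloisRep 3 →
      (∃ (W' : WeierstrassCurve ℚ) (_ : W'.IsElliptic) (_ : W'.IsGloballyMinimal),
        O6.ModPCongruent W' W 3 ∧ ¬ Addv W' 3 ∧ W'.HasSurjectiveModNGaloisRep 3) → BSDp W 3 := by
  obtain ⟨hB, hS0⟩ := h3
  refine bsdp_three_of_defectPT_of_nonOrdBucketsT_odd hF hD hwall hmu hPT hPT2 hYZ ?_ ?_ hsupply hV hC hZ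
  · intro W' _ _ N' _ K _ _ Dt' hm hsurj hN hK hH hodd κ hκ γ _ 𝔭 h𝔭 he hf 𝔭' h𝔭' hne ι' hι
    obtain ⟨ΩK, Ωp, L, hΩK, hΩp, hBDP, hk⟩ :=
      hB W' N' K Dt' hm hsurj hN hK hH hodd κ hκ γ 𝔭 h𝔭 he hf 𝔭' h𝔭' hne ι' hι
    exact ⟨ΩK, Ωp, L, hΩK, hΩp, hBDP, fun _ ↦ hk⟩
  · intro W' _ _ N' _ K _ _ Dt' hg ha hsurj hN hK hH hodd κ hκ γ _ 𝔭 h𝔭 he hf 𝔭' h𝔭' hne ι' hι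
    obtain ⟨ΩK, Ωp, L, hΩK, hΩp, hBDP, hk⟩ :=
      hS0 W' N' K Dt' hg ha hsurj hN hK hH hodd κ hκ γ 𝔭 h𝔭 he hf 𝔭' h𝔭' hne ι' hι
    exact ⟨ΩK, Ωp, L, hΩK, hΩp, hBDP, fun _ ↦ hk⟩

/-! ### §3 The item -/

/-- **Act E's kernel″ `ToricKernelAtThreeApZeroOddDefectPTOfPrint` (stmt-BirchSwinnertonDyer-26977) HOLDS**: unpack the printed
leaves (PT ×2 feed the squeeze AND the control `UniversalToricDescentControl.wildSplitControlAtThree_of_poitouTate`; Yan–Zhu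
feeds bucket A), V♯ from LZZ + the E-port as in kernel♭, and §2. The type is literally the route decl of rev 44. [folklore] -/
theorem toricKernelAtThreeApZeroOddDefectPTOfPrint_proof :
    Summit.BirchSwinnertonDyer.BirchSwinnertonDyer.Theses.UniversalToricDescent.ToricKernelAtThreeApZeroOddDefectPTOfPrint := by
  intro hF hD hA hM h3 hsupply hW hS hL hZ
  obtain ⟨hYZ, h1, h2⟩ := hL
  obtain ⟨hH, hB', hLZZ⟩ := hW
  exact bsdp_three_of_defectPT_of_nonOrdBuckets_odd hF hD hA hM h1 h2 hYZ h3
    (fun W _ _ hO6 hr hsurj htwin ↦ hsupply W hO6 hr hsurj htwin)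
    (UniversalToricDescentKernelOdd.wildSplitWaldspurgerAtThreeOdd_of_lzz_of_frameOdd hLZZ (hS hH hB'))
    (UniversalToricDescentControl.wildSplitControlAtThree_of_poitouTate h1 h2) hZ

/-- rev 44's `closes` body with its kernel″ hypothesis DISCHARGED: the registered leaf `WAllExclAddWildRankOneSurjTwin` from the
eight remaining displayed hypotheses (CONDITIONAL on every one of them; closes nothing by itself). [folklore] -/
theorem wAllExclAddWildRankOneSurjTwin_of_defectWallMu_of_nonOrdBuckets_of_print
    (hF : ToricPublishedInputs) (hP : ToricDefectWallMuAtThree) (h3 : TwinWanFrameAtThreeNonOrdBuckets)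
    (hsupply : GoodSSApZeroTwinSupplyAtThree) (hW : WildSplitPrintedInputsAtThree) (hS : WildSplitFrameAtThreeOddOfPrint)
    (hL : ToricPrintedLeavesAtThree) (hZ : WildRankZeroTwistAtThree) :
    Summit.BirchSwinnertonDyer.WAllExclAddWildRankOneSurjTwin :=
  Summit.BirchSwinnertonDyer.wAllExclAddWildRankOneSurjTwin_of_forall
    (toricKernelAtThreeApZeroOddDefectPTOfPrint_proof hF hP.1 hP.2.1 hP.2.2 h3 hsupply hW hS hL hZ)

end Summit.BirchSwinnertonDyer.BirchSwinnertonDyer.Theorems.UniversalToricDescentKernelDefectPTOfPrint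

end
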